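import Literature.Probability.RandomPlanarGeometry.SLEAdaptedProofs
import Literature.Probability.RandomPlanarGeometry.SLECrossingProbabilityProofs
import Literature.Probability.RandomPlanarGeometry.LocalMartingaleBoundedProofs
import HarnessLib

/-!
# Lawler's two-point observable is adapted; the Itô step reduces to a local-martingale property

Topic `Probability/RandomPlanarGeometry`; theorems only (proof sibling of `SLETwoPointMartingale`).
We prove the **adaptedness half** of the Itô-step fact `Literature.Probability.RandomPlanarGeometry.sle_martingale_twoPointObservable`:
for `κ > 4` and `y < 0 < x`, Lawler's regularised observable `Mₜ = Ψ_{2/κ}(Z_{t∧σ})`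
(`Literature.sleTwoPointObservable κ x y`) is strongly adapted to the raw Brownian filtration `𝓕ᵂ`
(`Literature.Probability.RandomPlanarGeometry.stronglyAdapted_sleTwoPointObservable`). With `LocalMartingaleBoundedProofs` (bounded
adapted local martingales are martingales) and `sleTwoPointObservable_mem_Icc`
(`SLECrossingProbabilityProofs`), the named fact — and with it Lawler's Prop. 6.33 and Cardy's
formula for SLE₆ — is thereby **reduced to the local-martingale property of the observable**
(`sle_martingale_twoPointObservable_of_isLocalMartingale`,
`CritPerc.sle_six_measureReal_hitsBefore_of_isLocalMartingale`), i.e. to exactly what Itô's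
formula for the two-point real Loewner flow delivers once the stochastic integral of
`Literature.Probability.Process.ItoCalculus` is constructed.

Proof: at time `t`, `Mₜ = Ψ(Zₜ)` on `{t < σ} = {t < T_x} ∩ {t < T_y} ∈ 𝓕ᵂ_t`
(`measurableSet_lt_swallowingTime_sle`), where `Zₜ = Xₜ/(Xₜ - Yₜ)` is a measurable function of the
adapted real flows `Xₜ`, `Yₜ` (`measurable_realFlow_sle`) with values in `(0, 1)`, on which `Ψ` is
continuous (`continuousOn_swallowingProb`); and on `{σ ≤ t}` it is the indicator of
`{T_y < T_x}`, whose trace `{σ ≤ t} ∩ {T_y < T_x} = ({T_y ≤ t} ∩ {t < T_x}) ∪ ⋃_{q ∈ ℚ ∩ [0,t]}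
({T_y ≤ q} ∩ {q < T_x})` is in `𝓕ᵂ_t` (events at times `q ≤ t`).

## References

* G. F. Lawler, *Conformally Invariant Processes in the Plane* (2005), §6.7, proof of Prop. 6.33.
* D. Revuz, M. Yor, *Continuous Martingales and Brownian Motion* (1999), Ch. I §4.
-/

noncomputable section

open Set Filter MeasureTheory Complex
open scoped NNReal

namespace Literature.Probability.RandomPlanarGeometry

open Loewner

variable {κ : ℝ≥0} {x y : ℝ}

/-- Events `{q < T_x}` at earlier times `q ≤ t` are in `𝓕ᵂ_t`. [folklore] -/
theorem measurableSet_coe_lt_swallowingTime_of_le (κ : ℝ≥0) {x : ℝ} (hx : x ≠ 0) {q t : ℝ≥0}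
    (hq : q ≤ t) :
    MeasurableSet[brownianFiltration t]
      {ω | (q : WithTop ℝ≥0) < swallowingTime (sleDriving κ ω) x} :=
  brownianFiltration.mono hq _ (measurableSet_lt_swallowingTime_sle κ hx q)

/-- Events `{T_x ≤ q}` at earlier times `q ≤ t` are in `𝓕ᵂ_t`. [folklore] -/
theorem measurableSet_swallowingTime_le_coe_of_le (κ : ℝ≥0) {x : ℝ} (hx : x ≠ 0) {q t : ℝ≥0}
    (hq : q ≤ t) :
    MeasurableSet[brownianFiltration t]
      {ω | swallowingTime (sleDriving κ ω) x ≤ (q : WithTop ℝ≥0)} := by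
  have h := (measurableSet_coe_lt_swallowingTime_of_le κ hx hq).compl
  have hset : {ω : ℝ≥0 → ℝ | swallowingTime (sleDriving κ ω) x ≤ (q : WithTop ℝ≥0)} =
      {ω | (q : WithTop ℝ≥0) < swallowingTime (sleDriving κ ω) x}ᶜ := by
    ext ω; simp only [mem_setOf_eq, mem_compl_iff, not_lt]
  rw [hset]
  exact h

/-- **The crossing event seen by time `t`**: `{σ ≤ t} ∩ {T_y < T_x} ∈ 𝓕ᵂ_t` (`x, y ≠ 0`). On this
event `T_y = σ ≤ t` and `x` is still alive at time `T_y`; a rational time `q ∈ (T_y, T_x ∧ t)`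
(or `q = t` when `T_y = t`) witnesses it through the `𝓕ᵂ_t`-events `{T_y ≤ q}`, `{q < T_x}`.
[folklore] -/
theorem measurableSet_twoPointTime_le_inter (κ : ℝ≥0) {x y : ℝ} (hx : x ≠ 0) (hy : y ≠ 0)
    (t : ℝ≥0) :
    MeasurableSet[brownianFiltration t]
      {ω | twoPointTime (sleDriving κ ω) x y ≤ t ∧
        swallowingTime (sleDriving κ ω) y < swallowingTime (sleDriving κ ω) x} := by
  set S : Set (ℝ≥0 → ℝ) := ({ω | swallowingTime (sleDriving κ ω) y ≤ (t : WithTop ℝ≥0)} ∩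
      {ω | (t : WithTop ℝ≥0) < swallowingTime (sleDriving κ ω) x}) ∪
    ⋃ q : ℚ, {ω | (q : ℝ) ∈ Icc (0 : ℝ) t ∧
      swallowingTime (sleDriving κ ω) y ≤ (((q : ℝ).toNNReal : ℝ≥0) : WithTop ℝ≥0) ∧
      (((q : ℝ).toNNReal : ℝ≥0) : WithTop ℝ≥0) < swallowingTime (sleDriving κ ω) x} with hS
  have hSm : MeasurableSet[brownianFiltration t] S := by
    refine ((measurableSet_swallowingTime_le_coe_of_le κ hy le_rfl).inter
      (measurableSet_coe_lt_swallowingTime_of_le κ hx le_rfl)).union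
      (MeasurableSet.iUnion fun q ↦ ?_)
    by_cases hq : (q : ℝ) ∈ Icc (0 : ℝ) t
    · have hqt : (q : ℝ).toNNReal ≤ t := (Real.toNNReal_le_iff_le_coe).2 hq.2
      have : {ω : ℝ≥0 → ℝ | (q : ℝ) ∈ Icc (0 : ℝ) t ∧
          swallowingTime (sleDriving κ ω) y ≤ (((q : ℝ).toNNReal : ℝ≥0) : WithTop ℝ≥0) ∧
          (((q : ℝ).toNNReal : ℝ≥0) : WithTop ℝ≥0) < swallowingTime (sleDriving κ ω) x} =
          {ω | swallowingTime (sleDriving κ ω) y ≤ (((q : ℝ).toNNReal : ℝ≥0) : WithTop ℝ≥0)} ∩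
          {ω | (((q : ℝ).toNNReal : ℝ≥0) : WithTop ℝ≥0) < swallowingTime (sleDriving κ ω) x} := by
        ext ω; simp [hq]
      rw [this]
      exact (measurableSet_swallowingTime_le_coe_of_le κ hy hqt).inter
        (measurableSet_coe_lt_swallowingTime_of_le κ hx hqt)
    · have : {ω : ℝ≥0 → ℝ | (q : ℝ) ∈ Icc (0 : ℝ) t ∧
          swallowingTime (sleDriving κ ω) y ≤ (((q : ℝ).toNNReal : ℝ≥0) : WithTop ℝ≥0) ∧
          (((q : ℝ).toNNReal : ℝ≥0) : WithTop ℝ≥0) < swallowingTime (sleDriving κ ω) x} = ∅ := by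
        ext ω; simp [hq]
      rw [this]
      exact @MeasurableSet.empty _ (brownianFiltration t)
  have hset : {ω : ℝ≥0 → ℝ | twoPointTime (sleDriving κ ω) x y ≤ t ∧
      swallowingTime (sleDriving κ ω) y < swallowingTime (sleDriving κ ω) x} = S := by
    ext ω
    simp only [hS, mem_setOf_eq, mem_union, mem_inter_iff, mem_iUnion]
    constructor
    · rintro ⟨hσ, hyx⟩
      have hTy : swallowingTime (sleDriving κ ω) y ≤ t := by
        rw [twoPointTime, min_eq_right hyx.le] at hσ; exact hσ
      rcases hTy.eq_or_lt with heq | hlt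
      · exact Or.inl ⟨hTy, heq ▸ hyx⟩
      · right
        -- a rational strictly between `T_y` and `min T_x t`
        have hTy' : swallowingTime (sleDriving κ ω) y ≠ ⊤ := ne_top_of_lt hlt
        obtain ⟨b, hb⟩ := WithTop.ne_top_iff_exists.1 hTy'
        have hbt : b < t := by rw [← hb] at hlt; exact_mod_cast hlt
        have hbmin : (b : WithTop ℝ≥0) < min (swallowingTime (sleDriving κ ω) x) t :=
          lt_min (hb ▸ hyx) (by exact_mod_cast hbt)
        -- choose a real rational in `(b, c)` where `c = min T_x t` as a real
        obtain ⟨c, hc⟩ : ∃ c : ℝ≥0, (c : WithTop ℝ≥0) = min (swallowingTime (sleDriving κ ω) x) t :=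
          ⟨(min (swallowingTime (sleDriving κ ω) x) t).untop (ne_top_of_le_ne_top WithTop.coe_ne_top
            (min_le_right _ _)), WithTop.coe_untop _ _⟩
        have hbc : b < c := by rw [← hc] at hbmin; exact_mod_cast hbmin
        obtain ⟨q, hbq, hqc⟩ := exists_rat_btwn (NNReal.coe_lt_coe.2 hbc)
        have hq0 : (0 : ℝ) ≤ q := b.coe_nonneg.trans hbq.le
        have hct : c ≤ t := by
          have : (c : WithTop ℝ≥0) ≤ t := hc ▸ min_le_right _ _
          exact_mod_cast this
        have hqt : (q : ℝ) ≤ t := hqc.le.trans (NNReal.coe_le_coe.2 hct)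
        have hqnn : ((q : ℝ).toNNReal : ℝ) = q := Real.coe_toNNReal _ hq0
        refine ⟨q, ⟨hq0, hqt⟩, ?_, ?_⟩
        · rw [← hb, WithTop.coe_le_coe, ← NNReal.coe_le_coe, hqnn]
          exact hbq.le
        · have h1 : (((q : ℝ).toNNReal : ℝ≥0) : WithTop ℝ≥0) < c := by
            rw [WithTop.coe_lt_coe, ← NNReal.coe_lt_coe, hqnn]; exact hqc
          exact lt_of_lt_of_le h1 (hc ▸ min_le_left _ _)
    · rintro (⟨hTy, htx⟩ | ⟨q, hq, hyq, hqx⟩)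
      · have hyx := lt_of_le_of_lt hTy htx
        exact ⟨(twoPointTime_le_right x y).trans hTy, hyx⟩
      · have hyx := lt_of_le_of_lt hyq hqx
        have hqt : (q : ℝ).toNNReal ≤ t := (Real.toNNReal_le_iff_le_coe).2 hq.2
        exact ⟨(twoPointTime_le_right x y).trans (hyq.trans (by exact_mod_cast hqt)), hyx⟩
  rw [hset]
  exact hSm

/-- `{t < σ} ∈ 𝓕ᵂ_t` (`x, y ≠ 0`). [folklore] -/
theorem measurableSet_coe_lt_twoPointTime (κ : ℝ≥0) {x y : ℝ} (hx : x ≠ 0) (hy : y ≠ 0) (t : ℝ≥0) :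
    MeasurableSet[brownianFiltration t] {ω | (t : WithTop ℝ≥0) < twoPointTime (sleDriving κ ω) x y} := by
  have : {ω : ℝ≥0 → ℝ | (t : WithTop ℝ≥0) < twoPointTime (sleDriving κ ω) x y} =
      {ω | (t : WithTop ℝ≥0) < swallowingTime (sleDriving κ ω) x} ∩
      {ω | (t : WithTop ℝ≥0) < swallowingTime (sleDriving κ ω) y} := by
    ext ω; simp only [mem_setOf_eq, mem_inter_iff]; exact coe_lt_twoPointTime_iff
  rw [this]
  exact (measurableSet_lt_swallowingTime_sle κ hx t).inter (measurableSet_lt_swallowingTime_sle κ hy t)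

/-- A measurable extension of `Ψₐ` from `[0, 1)` (where it is continuous) to `ℝ`. [folklore] -/
theorem measurable_piecewise_swallowingProb {a : ℝ} (ha0 : 0 < a) (ha : a < 1 / 2) :
    Measurable ((Ico (0 : ℝ) 1).piecewise (swallowingProb a) 0) := by
  classical
  exact (continuousOn_swallowingProb ha0 ha).measurable_piecewise continuousOn_const measurableSet_Ico

/-- **Lawler's two-point observable is strongly adapted to the raw Brownian filtration**
(`κ > 4`, `y < 0 < x`): at time `t` it is a measurable function of the `𝓕ᵂ_t`-measurable data
`{t < T_x}`, `{t < T_y}`, `re gₜ(x) - Wₜ`, `re gₜ(y) - Wₜ` (`SLEAdaptedProofs`) and of the event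
`{σ ≤ t} ∩ {T_y < T_x} ∈ 𝓕ᵂ_t`. The adaptedness half of `sle_martingale_twoPointObservable`.
Lawler (2005), proof of Prop. 6.33. [cite: Lawler2005, Prop. 6.33] -/
theorem stronglyAdapted_sleTwoPointObservable (hκ : 4 < κ) (hx : 0 < x) (hy : y < 0) :
    StronglyAdapted brownianFiltration (sleTwoPointObservable κ x y) := by
  intro t
  classical
  have ha : 2 / (κ : ℝ) ∈ Ioo (0 : ℝ) (1 / 2) := by
    have hκ' : (4 : ℝ) < κ := by exact_mod_cast hκ
    have hκ0 : (0 : ℝ) < κ := by linarith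
    refine ⟨div_pos two_pos hκ0, ?_⟩
    rw [div_lt_iff₀ hκ0]
    linarith
  set fx : (ℝ≥0 → ℝ) → ℝ := fun ω ↦
    if (t : WithTop ℝ≥0) < swallowingTime (sleDriving κ ω) x then
      (map (sleDriving κ ω) t x).re - sleDriving κ ω t else 0 with hfxdef
  set fy : (ℝ≥0 → ℝ) → ℝ := fun ω ↦
    if (t : WithTop ℝ≥0) < swallowingTime (sleDriving κ ω) y then
      (map (sleDriving κ ω) t y).re - sleDriving κ ω t else 0 with hfydef
  have hfx : Measurable[brownianFiltration t] fx := measurable_realFlow_sle κ hx.ne' t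
  have hfy : Measurable[brownianFiltration t] fy := measurable_realFlow_sle κ hy.ne t
  set E : Set (ℝ≥0 → ℝ) := {ω | (t : WithTop ℝ≥0) < twoPointTime (sleDriving κ ω) x y} with hEdef
  have hE : MeasurableSet[brownianFiltration t] E := measurableSet_coe_lt_twoPointTime κ hx.ne' hy.ne t
  set A : Set (ℝ≥0 → ℝ) := {ω | twoPointTime (sleDriving κ ω) x y ≤ t ∧
    swallowingTime (sleDriving κ ω) y < swallowingTime (sleDriving κ ω) x} with hAdef
  have hA : MeasurableSet[brownianFiltration t] A := measurableSet_twoPointTime_le_inter κ hx.ne' hy.ne t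
  set ψ : ℝ → ℝ := (Ico (0 : ℝ) 1).piecewise (swallowingProb (2 / (κ : ℝ))) 0 with hψdef
  have hψ : Measurable ψ := measurable_piecewise_swallowingProb ha.1 ha.2
  have key : sleTwoPointObservable κ x y t =
      fun ω ↦ if ω ∈ E then ψ (fx ω / (fx ω - fy ω)) else A.indicator 1 ω := by
    ext ω
    by_cases hω : ω ∈ E
    · have hlt : (t : WithTop ℝ≥0) < twoPointTime (sleDriving κ ω) x y := hω
      obtain ⟨htx, hty⟩ := coe_lt_twoPointTime_iff.1 hlt
      have hZ := sle_twoPointRatio_mem_Ioo (κ := κ) hx hy hlt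
      rw [if_pos hω, sleTwoPointObservable_of_lt hlt, hψdef,
        piecewise_eq_of_mem _ _ _ (Ioo_subset_Ico_self ?_)]
      · simp only [hfxdef, hfydef, if_pos htx, if_pos hty]
        rfl
      · simp only [hfxdef, hfydef, if_pos htx, if_pos hty]
        exact hZ
    · have hle : twoPointTime (sleDriving κ ω) x y ≤ t := not_lt.1 hω
      rw [if_neg hω, sleTwoPointObservable_of_le hle]
      by_cases hyx : swallowingTime (sleDriving κ ω) y < swallowingTime (sleDriving κ ω) x
      · rw [if_pos hyx, indicator_of_mem (show ω ∈ A from ⟨hle, hyx⟩), Pi.one_apply]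
      · rw [if_neg hyx, indicator_of_notMem (fun h : ω ∈ A ↦ hyx h.2)]
  rw [key]
  refine Measurable.stronglyMeasurable ?_
  have h1 : Measurable[brownianFiltration t] (A.indicator (1 : (ℝ≥0 → ℝ) → ℝ)) :=
    Measurable.indicator (f := (1 : (ℝ≥0 → ℝ) → ℝ)) measurable_const hA
  exact Measurable.ite hE (hψ.comp (hfx.div (hfx.sub hfy))) h1


/-! ### The Itô step reduces to the local-martingale property -/

/-- **Reduction of the Itô step to a local-martingale statement**: if, for `κ > 4` and `y < 0 < x`,
Lawler's observable `Ψ_{2/κ}(Z_{t∧σ})` is an `𝓕ᵂ`-local martingale (the literal output of Itô's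
formula for the two-point real Loewner flow together with the hypergeometric equation (6.21)),
then it is a martingale (`sle_martingale_twoPointObservable`): it is adapted
(`stronglyAdapted_sleTwoPointObservable`) and bounded by `1` (`sleTwoPointObservable_mem_Icc`), and
bounded adapted local martingales are martingales (`IsLocalMartingale.martingale_of_bounded`).
Lawler (2005), proof of Prop. 1.21 ("`M_t` is a bounded martingale"). [cite: Lawler2005, Prop. 6.33] -/
theorem sle_martingale_twoPointObservable_of_isLocalMartingale
    (h : ∀ ⦃κ : ℝ≥0⦄, 4 < κ → ∀ ⦃x y : ℝ⦄, 0 < x → y < 0 →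
      IsLocalMartingale (sleTwoPointObservable κ x y) brownianFiltration Process.preWienerMeasure) :
    sle_martingale_twoPointObservable := by
  intro κ hκ x y hx hy
  haveI := isProbabilityMeasure_preWienerMeasure'
  refine (h hκ hx hy).martingale_of_bounded (stronglyAdapted_sleTwoPointObservable hκ hx hy)
    (C := 1) fun t ω ↦ ?_
  have hm := sleTwoPointObservable_mem_Icc hκ hx hy t ω
  rw [abs_le]
  exact ⟨by linarith [hm.1], hm.2⟩

/-- **Cardy's formula for SLE₆ in a conformal rectangle from the local-martingale property**: the
target `CritPerc.sle_six_measureReal_hitsBefore` (`CritPercSLE`) follows from (i) the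
local-martingale property of Lawler's two-point observable for `κ > 4` (Itô's formula for the real
Loewner flow — the one remaining stochastic-calculus input on the martingale side) and (ii) a.s.
swallowing of positive reals for `κ > 4` (`sle_swallows_real_iff`, Rohde–Schramm Lemma 6.5).
[cite: Lawler2005, Prop. 6.33] -/
theorem sle_six_measureReal_hitsBefore_of_isLocalMartingale
    (h : ∀ ⦃κ : ℝ≥0⦄, 4 < κ → ∀ ⦃x y : ℝ⦄, 0 < x → y < 0 →
      IsLocalMartingale (sleTwoPointObservable κ x y) brownianFiltration Process.preWienerMeasure)
    (h₃ : Literature.Analysis.FunctionSpaces.sle_swallows_real_iff) : RandomPlanarGeometry.sle_six_measureReal_hitsBefore :=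
  RandomPlanarGeometry.sle_six_measureReal_hitsBefore_of_martingale
    (sle_martingale_twoPointObservable_of_isLocalMartingale h) h₃


/-- Variant with the a.s. finiteness of the swallowing times (`κ > 4`, per point) as the second
input instead of `sle_swallows_real_iff`. [cite: Lawler2005, Prop. 6.33] -/
theorem sle_six_measureReal_hitsBefore_of_isLocalMartingale_of_ae
    (h : ∀ ⦃κ : ℝ≥0⦄, 4 < κ → ∀ ⦃x y : ℝ⦄, 0 < x → y < 0 →
      IsLocalMartingale (sleTwoPointObservable κ x y) brownianFiltration Process.preWienerMeasure)
    (hfin : ∀ ⦃κ : ℝ≥0⦄, 4 < κ → ∀ ⦃x : ℝ⦄, 0 < x →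
      ∀ᵐ ω ∂Process.preWienerMeasure, swallowingTime (sleDriving κ ω) x < ⊤) :
    RandomPlanarGeometry.sle_six_measureReal_hitsBefore :=
  RandomPlanarGeometry.sle_six_measureReal_hitsBefore_of_martingale_of_ae
    (sle_martingale_twoPointObservable_of_isLocalMartingale h) hfin

end Literature.Probability.RandomPlanarGeometry
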